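import Summits.CriticalPhenomena.Ising3DConformalLimit.Theorems.PerfectScreeningCoulombImpliesNontrivialBlockLaw
import Summits.CriticalPhenomena.Ising3DConformalLimit.Theorems.PerfectScreeningCoulombImpliesNontrivialLeeYangPackage
import Literature.Probability.LatticeModels.BoxDirichlet
import HarnessLib

/-!
# Lee–Yang saturation deficit of the critical block spin (stub `stub_leeYangDeficit`, S2)

Line `one-arm-isotherm-lattice` of crux `MergingFloor` (route ArmHyperscaling, Ising3DConformalLimit), item
stmt-CriticalPhenomena-15592; verbatim also stub S2 of line `isotherm-saturation-lee-yang` of crux 0636.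

For the critical block spin `M_L = Σ_{x ∈ box 3 L} σ_x` (plus state at `β_c(3)`, zero field), with
`Σ_L = ⟨M_L²⟩`, `Q_L = ⟨M_L⁴⟩` and `Z(t) = ⟨e^{tM_L}⟩`: for every `t ≥ 0`, `Z(t) > 0` and
`(Σ_L t − t³ (3Σ_L² − Q_L)) · Z(t) ≤ ⟨M_L e^{tM_L}⟩`, i.e. the tilted mean falls short of its linear
response by at most `t³ · (−u₄(M_L))`.

Proof. By the landed Lee–Yang structure of the block law (`stub_blockLaw` + `stub_leeYangPackage`,
C. M. Newman 1975): `Z(t) = cosh^m t ∏ᵢ (1 + bᵢ sinh² t)` with `bᵢ ≥ 1`, the tilted mean is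
`Z(t) · (m tanh t + Σᵢ 2bᵢ sinh t cosh t / (1 + bᵢ sinh² t))`, `Σ_L = m + 2Σbᵢ`, and Newman's coefficient
inequality `2m + 12Σbᵢ² − 8Σbᵢ ≤ 3Σ_L² − Q_L` holds. Since `bᵢ ≥ 1` gives `12bᵢ² − 8bᵢ ≥ 4bᵢ²`, it
suffices to prove termwise, for `t ≥ 0`, `t − 2t³ ≤ tanh t` and `t − 2bt³ ≤ sinh t cosh t / (1 + b sinh² t)`
(`b ≥ 1`). Both follow from the two elementary facts `t ≤ sinh t cosh t` (`= sinh(2t)/2`) and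
`sinh t ≤ t cosh t` (tree lemma `Literature.Probability.LatticeModels.sinh_le_mul_cosh`):
`t − tanh t ≤ t − t/cosh² t = t tanh² t ≤ t³`, and
`t − sc/(1+bs²) ≤ t − t/(1+bs²) = t·bs²/(1+bs²) ≤ t·b·s²/cosh² t ≤ b t³`.
-/

noncomputable section

namespace Summit.CriticalPhenomena.Ising3DConformalLimit.ArmHyperscalingMergingFloor

open Literature.Probability.LatticeModels Filter Set Finset
open scoped Topology BigOperators

/-! ### Elementary hyperbolic inequalities on `[0, ∞)` -/

/-- `t ≤ sinh t · cosh t` for `t ≥ 0` (`sinh t cosh t = sinh(2t)/2 ≥ 2t/2`). -/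
theorem self_le_sinh_mul_cosh {t : ℝ} (ht : 0 ≤ t) : t ≤ Real.sinh t * Real.cosh t := by
  have h := Real.self_le_sinh_iff.2 (by linarith : (0 : ℝ) ≤ 2 * t)
  rw [Real.sinh_two_mul] at h
  linarith

/-- `0 ≤ tanh t ≤ t` for `t ≥ 0` (the upper bound is `sinh t ≤ t cosh t`, tree lemma `sinh_le_mul_cosh`). -/
theorem tanh_nonneg_and_le_self {t : ℝ} (ht : 0 ≤ t) : 0 ≤ Real.tanh t ∧ Real.tanh t ≤ t := by
  rw [Real.tanh_eq_sinh_div_cosh]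
  exact ⟨div_nonneg (Real.sinh_nonneg_iff.2 ht) (Real.cosh_pos t).le,
    (div_le_iff₀ (Real.cosh_pos t)).2 (sinh_le_mul_cosh ht)⟩

/-- The `cosh`-mode bound: `t − 2t³ ≤ tanh t` for `t ≥ 0` (indeed `t − tanh t ≤ t tanh² t ≤ t³`). -/
theorem self_sub_two_mul_cube_le_tanh {t : ℝ} (ht : 0 ≤ t) : t - 2 * t ^ 3 ≤ Real.tanh t := by
  obtain ⟨h0, h1⟩ := tanh_nonneg_and_le_self ht
  have hsc := self_le_sinh_mul_cosh ht
  have hc := Real.cosh_pos t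
  have htanh : Real.tanh t * Real.cosh t = Real.sinh t := by
    rw [Real.tanh_eq_sinh_div_cosh, div_mul_cancel₀ _ hc.ne']
  have hcs : Real.cosh t ^ 2 = Real.sinh t ^ 2 + 1 := Real.cosh_sq t
  -- `(t - tanh t - t tanh² t) cosh² t = t - sinh t cosh t ≤ 0`
  have key : (t - Real.tanh t - t * Real.tanh t ^ 2) * Real.cosh t ^ 2 =
      t - Real.sinh t * Real.cosh t := by
    linear_combination (-(Real.cosh t) - t * (Real.tanh t * Real.cosh t + Real.sinh t)) * htanh + t * hcs
  have hneg : t - Real.tanh t - t * Real.tanh t ^ 2 ≤ 0 := by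
    by_contra hpos
    have := mul_pos (not_le.1 hpos) (pow_pos hc 2)
    linarith
  have hsq : Real.tanh t ^ 2 ≤ t ^ 2 := pow_le_pow_left₀ h0 h1 2
  nlinarith [mul_le_mul_of_nonneg_left hsq ht]

/-- The Lee–Yang-pair bound: `t − 2bt³ ≤ sinh t cosh t / (1 + b sinh² t)` for `t ≥ 0`, `b ≥ 1`
(indeed `≥ t − bt³`: `t − sc/(1+bs²) ≤ t bs²/(1+bs²) ≤ t b tanh² t ≤ bt³`). -/
theorem self_sub_le_sinh_mul_cosh_div {t b : ℝ} (ht : 0 ≤ t) (hb : 1 ≤ b) :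
    t - 2 * b * t ^ 3 ≤ Real.sinh t * Real.cosh t / (1 + b * Real.sinh t ^ 2) := by
  have hb0 : 0 ≤ b := zero_le_one.trans hb
  have hs : 0 ≤ Real.sinh t := Real.sinh_nonneg_iff.2 ht
  have hD : 0 < 1 + b * Real.sinh t ^ 2 := by positivity
  rw [le_div_iff₀ hD]
  have hsc := self_le_sinh_mul_cosh ht
  have hcs : Real.cosh t ^ 2 = Real.sinh t ^ 2 + 1 := Real.cosh_sq t
  -- `sinh² t ≤ t² cosh² t = t² (1 + sinh² t) ≤ t² (1 + b sinh² t)`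
  have h2 : Real.sinh t ^ 2 ≤ (t * Real.cosh t) ^ 2 := pow_le_pow_left₀ hs (sinh_le_mul_cosh ht) 2
  have h3 : Real.sinh t ^ 2 ≤ t ^ 2 * (1 + b * Real.sinh t ^ 2) := by
    rw [mul_pow, hcs] at h2
    nlinarith [mul_nonneg (mul_nonneg (sq_nonneg t) (sq_nonneg (Real.sinh t))) (sub_nonneg.2 hb)]
  -- `(t − 2bt³)(1 + bs²) = t + b t s² − 2bt³(1 + bs²) ≤ t + bt³(1+bs²) − 2bt³(1+bs²) ≤ t ≤ sc`
  have h4 : b * t * Real.sinh t ^ 2 ≤ b * t * (t ^ 2 * (1 + b * Real.sinh t ^ 2)) :=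
    mul_le_mul_of_nonneg_left h3 (mul_nonneg hb0 ht)
  have h5 : 0 ≤ b * t ^ 3 * (1 + b * Real.sinh t ^ 2) := by positivity
  nlinarith [h4, h5, hsc]

/-! ### The registered stub -/

/-- **S2 — LEE–YANG SATURATION DEFICIT.** For the critical block spin `M_L = Σ_{x ∈ box 3 L} σ_x`
(plus state at `β_c(3)`, zero field) and every tilt `t ≥ 0`: `⟨e^{tM_L}⟩ > 0` and
`(Σ_L t − t³(3Σ_L² − ⟨M_L⁴⟩)) · ⟨e^{tM_L}⟩ ≤ ⟨M_L e^{tM_L}⟩` (`Σ_L = ⟨M_L²⟩`), i.e. the deficit of the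
tilted mean below its linear response is at most `t³ · (−u₄(M_L))`. From the Lee–Yang product structure of
the block law (`stub_blockLaw` + `stub_leeYangPackage`: `⟨e^{tM}⟩ = cosh^m t ∏ (1 + bᵢ sinh² t)`, `bᵢ ≥ 1`,
tilted mean, `Σ_L = m + 2Σbᵢ`, Newman's `2m + 12Σbᵢ² − 8Σbᵢ ≤ 3Σ_L² − ⟨M_L⁴⟩`) and the termwise bounds
`t − 2t³ ≤ tanh t`, `t − 2bᵢt³ ≤ sinh t cosh t/(1 + bᵢ sinh² t)`. -/
theorem stub_leeYangDeficit :
    ∀ (L : ℕ) (t : ℝ), 0 ≤ t →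
      0 < plusExpect 3 (criticalBeta 3) 0 (fun σ => Real.exp (t * ∑ x ∈ box 3 L, spinAt x σ)) ∧
      (plusExpect 3 (criticalBeta 3) 0 (fun σ => (∑ x ∈ box 3 L, spinAt x σ) ^ 2) * t -
          t ^ 3 * (3 * (plusExpect 3 (criticalBeta 3) 0 (fun σ => (∑ x ∈ box 3 L, spinAt x σ) ^ 2)) ^ 2 -
            plusExpect 3 (criticalBeta 3) 0 (fun σ => (∑ x ∈ box 3 L, spinAt x σ) ^ 4))) *
        plusExpect 3 (criticalBeta 3) 0 (fun σ => Real.exp (t * ∑ x ∈ box 3 L, spinAt x σ)) ≤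
      plusExpect 3 (criticalBeta 3) 0
        (fun σ => (∑ x ∈ box 3 L, spinAt x σ) * Real.exp (t * ∑ x ∈ box 3 L, spinAt x σ)) := by
  intro L t ht
  obtain ⟨p, hp0, hsymm, hpar, hmass, hlaw, hLY⟩ :=
    PerfectScreeningCoulombImpliesNontrivial.stub_blockLaw L
  obtain ⟨m, n, b, hb, -, -, hexp, htilt, hvar, hnewman, -⟩ :=
    PerfectScreeningCoulombImpliesNontrivial.stub_leeYangPackage ((2 * L + 1) ^ 3) p hp0 hsymm hpar hmass hLY
  rw [hlaw (fun u => Real.exp (t * u)), hlaw (fun u => u * Real.exp (t * u)), hlaw (fun u => u ^ 2),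
    hlaw (fun u => u ^ 4), hexp t, htilt t, ← hvar]
  rw [← hvar] at hnewman
  have hZ : 0 < Real.cosh t ^ m * ∏ i, (1 + b i * Real.sinh t ^ 2) :=
    mul_pos (pow_pos (Real.cosh_pos t) m) (Finset.prod_pos fun i _ => by have := hb i; positivity)
  refine ⟨hZ, ?_⟩
  rw [mul_comm]
  refine mul_le_mul_of_nonneg_left ?_ hZ.le
  -- termwise bounds
  have hm0 : (0 : ℝ) ≤ m := Nat.cast_nonneg m
  have ht3 : 0 ≤ t ^ 3 := by positivity
  have hA := mul_le_mul_of_nonneg_left (self_sub_two_mul_cube_le_tanh ht) hm0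
  have hB : ∑ i, 2 * b i * (t - 2 * b i * t ^ 3) ≤
      ∑ i, 2 * b i * Real.sinh t * Real.cosh t / (1 + b i * Real.sinh t ^ 2) := by
    refine Finset.sum_le_sum fun i _ => ?_
    have h2b : 0 ≤ 2 * b i := by linarith [hb i]
    calc 2 * b i * (t - 2 * b i * t ^ 3)
        ≤ 2 * b i * (Real.sinh t * Real.cosh t / (1 + b i * Real.sinh t ^ 2)) :=
          mul_le_mul_of_nonneg_left (self_sub_le_sinh_mul_cosh_div ht (hb i)) h2b
      _ = 2 * b i * Real.sinh t * Real.cosh t / (1 + b i * Real.sinh t ^ 2) := by ring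
  have hBeq : ∑ i, 2 * b i * (t - 2 * b i * t ^ 3) = 2 * t * ∑ i, b i - 4 * t ^ 3 * ∑ i, b i ^ 2 := by
    rw [Finset.mul_sum, Finset.mul_sum, ← Finset.sum_sub_distrib]
    exact Finset.sum_congr rfl fun i _ => by ring
  rw [hBeq] at hB
  have hbb : ∑ i, b i ≤ ∑ i, b i ^ 2 := Finset.sum_le_sum fun i _ => by nlinarith [hb i]
  have hK := mul_le_mul_of_nonneg_left hnewman ht3
  have hbb' := mul_le_mul_of_nonneg_left hbb ht3
  linarith

end Summit.CriticalPhenomena.Ising3DConformalLimit.ArmHyperscalingMergingFloor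

end
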